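/- Copyright: the b2b-balaban cell (near-miss cell 7), T⁴-continuum fan-out, lineage t4-ne7b-p1 (node U5c COUNT
member).  Released under the licence of the surrounding project. -/
import Summits.QuantumFields.BalabanUV.T4Continuum.Support.HistoryBankingPedigreeLedger82
import Summits.QuantumFields.BalabanUV.T4Continuum.Support.HistoryBankingJoinLag

/-!
# M5-2e (E4) — THE PER-LEVEL DEAD-BOX VOLUME LEDGER: the step before the lag, the fresh-level exchange
`Σ_m u_m·nfresh ≤ 14·Γ·bfee`, the summed ledger, and its calibrated form under the floor display
`u_t·(6·collar82 d) ≤ floorK C K R t` (owner module of row NE7b, lineage `t4-ne7b-p1` gen 51; re-open object (α), ruling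
R-OWNER-51-1 «THE CENSUS READING AFTER VOLUME-3; M5-2e COMMISSIONED»; PRE-POSITIONING ONLY)

Summits-side support leaf of the T⁴-continuum cell (rung (B)+1 on a FINITE torus only; NOT infinite volume, NOT the
mass gap, NOT the Clay statement; NOT a proof of the spine estimate NE7b — the cell's OWN estimate, NOT PRINTED, NOT
PROVED).  [folklore] finite combinatorics and real arithmetic over the lineage's own bricks (E3
`HistoryBankingPedigreeLedger82` (`perStep82`, `nfresh`, `oldAnchors`, `card_MDP_le_three`), E2 `HistoryBankingAnchors82`
(`collar82`, `feed82`, `card_biUnion_box82_le`), M5-2d's sibling `HistoryBankingJoinLag` (`nj`, `jfee`,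
`compSum_one_lag_le`, `sum_nj_le_jfee`, `jfee_le_bfee`, `bfee_le_blin`), M5-1b `HistoryBankingFlatJunction` (`nb`,
`nb_eq_recent`, `sum_nb_le_bfee`, `compSum_affine`, `card_deadAnchors_le_nb`), A2 `HistoryBankingFlatLedger.flat_total_le`,
A3c `HistoryBankingFloors.sum_ncomp_floorK_le_lifeCost`, `HistoryBankingBirthBookings` (`sum_youngVol_le`,
`sum_bsum_le_lifeCost`, `blin`, `bfee`)); nothing printed is asserted, no cite-tagged hypothesis, no `def … : Prop`, zero
`sorry`.  One `def` (the explicit class-linear coefficient `cvol82`).  B16 = [Balaban1989LargeFieldII] pp. 384–387 under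
audit; locators only.

WHY (ruling R-OWNER-51-1; refuter PRICING-NE7b v19 F99 lever (g1′); balaban-calc G39 «VOLUME-3»).  M5-2d's
`shrunk_volume_le_lifeCost` asks the LAG-FREE floor display `u_t·(6·1122^d) ≤ floorK C K R t`; its constant is A1's
all-steps dead-orbit box (`561^d` per anchor × `2^d` anchors), vacuous at ratio one by 3.1 orders under the census
reading of record (A).  E2∕E3 re-run the per-step inequality with the per-level box (radius `82` from the `14`th step
after condition (i); a fully decayed footprint's `82`-thickening costs `collar82 d = 165^d + (2^d − 1)·d·165^{d−1}`); the
`< 14` fresh-dead levels of each birth (`561^d` cubes) and the recent old-dead births (`165^d`) go to the births'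
class-linear credit.  THIS FILE sums it: §1 **`sum_nfresh_le_bfee`** (a birth is fresh-dead only at the levels
`j_b + a₀ ≤ m ≤ j_b + a₀ + 13`, `a₀` its first condition-(i) index); §2 BEFORE THE LAG (`m < j`):
`V(m) ≤ Y(m) + 561^d·nfresh + 165^d·nb j P m`; §3 **`shrunk82_volume_le`** (raw, any `σ > 0`):
`Σ_{m≤K} u_m·V(m) ≤ (2 + 2·collar82 d∕σ)·lifeCost + (2^{d+3} + 28·561^d·Γ + 2·collar82 d·j·Γ² + 2·165^d·j·Γ)·blin u P`
under `u_t·σ ≤ floorK`, `feed82 d·Γ ≤ 2^j∕2` and M5-1a's two displays (M5-2d's proof with `perStep ↦ perStep82`); §4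
**`cvol82 d j Γ`** and the CALIBRATED **`shrunk82_volume_le_lifeCost`**: under `u_t·(6·collar82 d) ≤ floorK C K R t`
(`t ≤ K`) — `6·collar82 4 = 6 064 368 750` where M5-2d had `6·1122⁴ = 9 508 733 552 736` —
`Σ_{m≤K} u_m·V(m) ≤ lifeCost … G + cvol82 d j Γ·blin u P` (M5-2d's right-hand side KIND at the new weight).
CENSUS NOTE (the OWNER's reading, desk floats for balaban-calc «VOLUME-4»; not a kernel fact).  Reading (A),
`E₂ = c_{E₂}M^d64^d`: the lattice floor-exchange threshold becomes `(6·collar82 4∕64⁴)·ρ = 361.46·ρ` (`ρ = cΛ∕c_{E₂}`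
unvalued) — census-NIL iff `ρ ≤ 1.2067` (m′ = 1) … `1.5632` (m′ = 6): NIL at ratio one, where M5-2d's `5.6676·10⁵·ρ`
was vacuous by 3.11 orders; reading (B′) is the refuter's labelled relabelling rider (F99 (4)(iii)); the feedback letter
drops to `feed82 d` (lattice lag 66, was 78).  NOT HERE: the witness plug (E5), `VolumeDisplaysS82` (leaf-06), the record
twin (custodian).  HONEST: the lineage's own bookkeeping; NE7b NOT proved; spine 0∕9.  HONEST DEPENDENCY (cell):
continuum YM on T⁴ ⇐ BetaPertH ∧ nine spine estimates (0∕9 proved); BetaPertH ⇐ (D1) ∧ (D4) ∧ CAP+tail; G-an2-4 gates asym, D1 and NE2∕3∕4.  This file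
changes none of it.
-/

open Finset
open Literature.MathematicalPhysics.QuantumFieldTheory.Balaban1983to89
open Literature.MathematicalPhysics.QuantumFieldTheory.Balaban1983to89.B13ScaleTransfer
open Literature.MathematicalPhysics.QuantumFieldTheory.Balaban1983to89.B16SProfile
open Literature.MathematicalPhysics.QuantumFieldTheory.Balaban1983to89.B16StoppingRule
open T4PersistenceDictionary T4PrintedShapeBanking T4TaggedShapeBanking T4BankedInduction T4BranchingRecordsGas
open Summit.QuantumFields.BalabanUV.T4Continuum.HistoryAdmissible
open Summit.QuantumFields.BalabanUV.T4Continuum.HistoryRealise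
open Summit.QuantumFields.BalabanUV.T4Continuum.HistoryRealiseWeak
open Summit.QuantumFields.BalabanUV.T4Continuum.HistoryBankingPedigreeMax
open Summit.QuantumFields.BalabanUV.T4Continuum.HistoryBankingPedigreeLedger
open Summit.QuantumFields.BalabanUV.T4Continuum.HistoryBankingFloors
open Summit.QuantumFields.BalabanUV.T4Continuum.HistoryBankingBirthBookings
open Summit.QuantumFields.BalabanUV.T4Continuum.HistoryBankingFlatLedger
open Summit.QuantumFields.BalabanUV.T4Continuum.HistoryBankingFlatJunction
open Summit.QuantumFields.BalabanUV.T4Continuum.HistoryBankingJoinLag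
open Summit.QuantumFields.BalabanUV.T4Continuum.HistoryBankingAnchors82
open Summit.QuantumFields.BalabanUV.T4Continuum.HistoryBankingPedigreeLedger82

namespace Summit.QuantumFields.BalabanUV.T4Continuum.HistoryBankingShrunkLedger82

noncomputable section

open scoped Classical

variable {d : ℕ} {γ : Type*} {ε : Type*} [DecidableEq ε]

/-! ## §1 The fresh-level exchange: each birth is fresh-dead at no more than `14` levels -/

section Fresh
variable {L : ℕ} {s : ℕ → ℕ}

/-- **EACH BIRTH IS FRESH-DEAD AT NO MORE THAN `14` LEVELS**: with the cumulative growth `u_n ≤ Γ·u_t` (`t ≤ n`, `Γ ≥ 0`),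
`Σ_{m≤K} u_m·nfresh P m ≤ 14·Γ·bfee u P` — a birth at `j_b` whose orbit first meets condition (i) at the relative index
`a₀` is fresh-dead only at the levels `j_b + a₀ ≤ m ≤ j_b + a₀ + 13`. [folklore] -/
theorem sum_nfresh_le_bfee {K : ℕ} {u : ℕ → ℝ} (hu : ∀ n, 0 ≤ u n) {Γ : ℝ} (hΓ0 : 0 ≤ Γ)
    (hΓ : ∀ t n, t ≤ n → u n ≤ Γ * u t) :
    ∀ P : PGen (Pt d × Finset (Pt d)),
      ∑ m ∈ Finset.range (K + 1), u m * (nfresh L s P m : ℝ) ≤ 14 * Γ * bfee u P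
  | .birth jb cls zZ => by
      have hb : bfee u (PGen.birth jb cls zZ) = u jb := rfl
      rw [hb]
      by_cases hex : ∃ i, CondI 100 (orbit L s jb zZ.2 i)
      · -- the first condition-(i) index
        set a₀ := Nat.find hex with ha₀
        have hspec : CondI 100 (orbit L s jb zZ.2 a₀) := Nat.find_spec hex
        have hterm : ∀ m ∈ Finset.range (K + 1), u m * (nfresh L s (PGen.birth jb cls zZ) m : ℝ) ≤
            if m ∈ Finset.Icc (jb + a₀) (jb + a₀ + 13) then u m else 0 := by
          intro m _
          unfold nfresh
          by_cases hf : (jb ≤ m ∧ ∃ i, i ≤ m - jb ∧ CondI 100 (orbit L s jb zZ.2 i)) ∧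
              ¬ (∃ i, i + 14 ≤ m - jb ∧ CondI 100 (orbit L s jb zZ.2 i))
          · rw [if_pos hf]
            obtain ⟨⟨hjm, i, hi, hI⟩, hno⟩ := hf
            have h1 : a₀ ≤ i := Nat.find_min' hex hI
            have h2 : ¬ (a₀ + 14 ≤ m - jb) := fun h => hno ⟨a₀, h, hspec⟩
            rw [if_pos (by rw [Finset.mem_Icc]; omega)]
            simp
          · rw [if_neg hf]
            split_ifs
            · simp [hu m]
            · simp
        refine (Finset.sum_le_sum hterm).trans ?_
        rw [← Finset.sum_filter]
        have hcard : (Finset.Icc (jb + a₀) (jb + a₀ + 13)).card = 14 := by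
          rw [Nat.card_Icc]; omega
        calc ∑ m ∈ (Finset.range (K + 1)).filter (fun m => m ∈ Finset.Icc (jb + a₀) (jb + a₀ + 13)), u m
            ≤ ∑ m ∈ Finset.Icc (jb + a₀) (jb + a₀ + 13), u m :=
              Finset.sum_le_sum_of_subset_of_nonneg (fun m hm => (Finset.mem_filter.1 hm).2) fun m _ _ => hu m
          _ ≤ ∑ m ∈ Finset.Icc (jb + a₀) (jb + a₀ + 13), Γ * u jb :=
              Finset.sum_le_sum fun m hm => hΓ jb m (by rw [Finset.mem_Icc] at hm; omega)
          _ = 14 * Γ * u jb := by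
              rw [Finset.sum_const, hcard, nsmul_eq_mul]; push_cast; ring
      · -- the orbit never meets condition (i): never fresh-dead
        have h0 : ∀ m, nfresh L s (PGen.birth jb cls zZ) m = 0 := by
          intro m
          unfold nfresh
          rw [if_neg]
          rintro ⟨⟨-, i, -, hI⟩, -⟩
          exact hex ⟨i, hI⟩
        simp only [h0, Nat.cast_zero, mul_zero, Finset.sum_const_zero]
        have := hu jb
        positivity
  | .renew G h => by
      have ih := sum_nfresh_le_bfee (K := K) hu hΓ0 hΓ G
      have e1 : ∀ m, (nfresh L s (PGen.renew G h) m : ℝ) = nfresh L s G m := fun m => rfl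
      simp only [e1]; exact ih
  | .join X Y sj => by
      have ihX := sum_nfresh_le_bfee (K := K) hu hΓ0 hΓ X
      have ihY := sum_nfresh_le_bfee (K := K) hu hΓ0 hΓ Y
      have e1 : ∀ m, u m * (nfresh L s (PGen.join X Y sj) m : ℝ) =
          u m * (nfresh L s X m : ℝ) + u m * (nfresh L s Y m : ℝ) :=
        fun m => by rw [nfresh_join]; push_cast; ring
      simp only [e1, Finset.sum_add_distrib]
      change _ ≤ 14 * Γ * (bfee u X + bfee u Y)
      linarith

end Fresh

/-! ## §2 Before the lag: every birth that has happened is within the lag -/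

section BeforeLag
variable {L : ℕ} {s R : ℕ → ℕ}

/-- before the lag the old anchors are at most `nb` (via `oldAnchors ⊆ deadAnchors` and M5-1b's `card_deadAnchors_le_nb`)
[folklore] -/
theorem card_oldAnchors_le_nb {j m : ℕ} (hmj : m < j) (P : PGen (Pt d × Finset (Pt d))) :
    (oldAnchors L s P m).card ≤ nb j P m :=
  (Finset.card_le_card (oldAnchors_subset_deadAnchors P m)).trans (card_deadAnchors_le_nb hmj P)

/-- **BEFORE THE LAG**: for `m < j`, `V(m) ≤ Y(m) + 561^d·nfresh P m + 165^d·nb j P m` (the cover component by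
component; one radius-`82` box per old anchor, at most `nb` of them). [folklore] -/
theorem compSum_id_le_of_lt_lag82 (hL : 2 ≤ L) (hdrop : ∀ m, DropCtl s m) {j m : ℕ} (hmj : m < j) :
    ∀ (P : PGen (Pt d × Finset (Pt d))) (Z : Finset (Pt d)), RealisesW L s R P Z →
      compSum L s (fun v => (v : ℝ)) P m ≤
        youngVol L s P m + 561 ^ d * (nfresh L s P m : ℝ) + 165 ^ d * (nb j P m : ℝ)
  | P, Z, hP => by
      by_cases hlast : P.lastStep ≤ m
      · rw [compSum_of_le P (adm_of_realisesW P Z hP le_rfl) hlast]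
        have h1 := card_MDP_le_three hL hdrop hP m
        have h2 := card_biUnion_box82_le (d := d) (oldAnchors L s P m)
        have h3 : ((oldAnchors L s P m).card : ℝ) ≤ (nb j P m : ℝ) := by exact_mod_cast card_oldAnchors_le_nb hmj P
        have h5 : (0 : ℝ) ≤ 165 ^ d := by positivity
        nlinarith [mul_le_mul_of_nonneg_left h3 h5]
      · match P, hP with
        | .birth jb cls zZ, hP =>
            simp only [PGen.lastStep] at hlast
            have h0 : compSum L s (fun v => (v : ℝ)) (PGen.birth jb cls zZ) m = 0 := by
              unfold compSum; rw [if_neg hlast]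
            rw [h0]
            have := youngVol_nonneg (L := L) (s := s) (PGen.birth jb cls zZ) m
            positivity
        | .renew Q h, hP =>
            obtain ⟨ZQ, hQ, -⟩ := hP
            exact compSum_id_le_of_lt_lag82 hL hdrop hmj Q ZQ hQ
        | .join X Y sj, hP =>
            simp only [PGen.lastStep] at hlast
            obtain ⟨ZX, ZY, hX, hY, -⟩ := hP
            have ihX := compSum_id_le_of_lt_lag82 hL hdrop hmj X ZX hX
            have ihY := compSum_id_le_of_lt_lag82 hL hdrop hmj Y ZY hY
            have h0 : compSum L s (fun v => (v : ℝ)) (PGen.join X Y sj) m =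
                compSum L s (fun v => (v : ℝ)) X m + compSum L s (fun v => (v : ℝ)) Y m := by
              conv_lhs => unfold compSum
              rw [if_neg hlast]
            rw [h0, youngVol_join]
            have hn : (nb j (PGen.join X Y sj) m : ℝ) = nb j X m + nb j Y m := by
              change ((nb j X m + nb j Y m : ℕ) : ℝ) = _; push_cast; ring
            have hf : (nfresh L s (PGen.join X Y sj) m : ℝ) = nfresh L s X m + nfresh L s Y m := by
              rw [nfresh_join]; push_cast; ring
            rw [hn, hf]
            linarith

end BeforeLag

/-! ## §3 The per-level dead-box ledger assembled (raw floor display) -/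

section Assembly
variable {L : ℕ} {s R : ℕ → ℕ} {C : T4PrintedShapeBanking.Consts} {sh : ε → PEv}

/-- **THE PER-LEVEL DEAD-BOX LEDGER (raw displays).**  Realised pedigree observed by the cutoff (`lastStep ≤ K`),
well-formed tagged genealogy over it pending at `K`, flow `L ≥ 4` with drop control, sizes `R ≥ 1`, allowance `C.n₁ ≥ 13`,
`E₂, E₃ ≥ 0`; unit costs `u ≥ 0` with the CUMULATIVE growth `u_n ≤ Γ·u_t` (`t ≤ n`; `Γ ≥ 0`), a lag `j ≥ 1` with
`feed82 d·Γ ≤ 2^j∕2`; the floor display `u_t·σ ≤ floorK C K R t` (`t ≤ K`, any `σ > 0`) and M5-1a's two: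
`Σ_{m≤K} u_m·V(m) ≤ (2 + 2·collar82 d∕σ)·lifeCost (dictWT sh R C.n₁) (costT sh C K R) G
  + (2^{d+3} + 28·561^d·Γ + 2·collar82 d·j·Γ² + 2·165^d·j·Γ)·blin u P`. [folklore] -/
theorem shrunk82_volume_le (hL : 4 ≤ L) (hdrop : ∀ m, DropCtl s m) (hR : ∀ t, 1 ≤ R t) (hn₁ : 13 ≤ C.n₁)
    (hE₂ : 0 ≤ C.E₂) (hE₃ : 0 ≤ C.E₃) {P : PGen (Pt d × Finset (Pt d))} {Z : Finset (Pt d)}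
    (hP : RealisesW L s R P Z) {G : Gen ε} (hsh : relabel sh G = P.toGen) (hW : G.WF (dictWT sh R C.n₁)) {K : ℕ}
    (hPK : P.lastStep ≤ K) (hK : K < G.reach (dictWT sh R C.n₁)) {u : ℕ → ℝ} (hu : ∀ n, 0 ≤ u n) {Γ : ℝ}
    (hΓ0 : 0 ≤ Γ) (hΓ : ∀ t n, t ≤ n → u n ≤ Γ * u t) {j : ℕ} (hj1 : 1 ≤ j)
    (hsmall : feed82 d * Γ ≤ 2 ^ j / 2) {σ : ℝ} (hσ : 0 < σ)
    (huS : ∀ t, t ≤ K → u t * σ ≤ floorK C K R t)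
    (huE₂ : ∀ n, n ≤ K → u n * (5 * 126 ^ d) ≤ C.E₂ * (R n : ℝ) ^ C.q')
    (huE₃ : ∀ n, n ≤ K → u n * (8 * 126 ^ d) ≤ C.E₃ * (R n : ℝ) ^ C.q') :
    ∑ m ∈ Finset.range (K + 1), u m * compSum L s (fun v => (v : ℝ)) P m ≤
      (2 + 2 * collar82 d / σ) * lifeCost (dictWT sh R C.n₁) (costT sh C K R) G
        + (2 ^ (d + 3) + 28 * 561 ^ d * Γ + 2 * collar82 d * j * Γ ^ 2 + 2 * 165 ^ d * j * Γ) * blin u P := by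
  set ε₀ : ℝ := feed82 d / 2 ^ j with hε₀
  have hε0 : 0 ≤ ε₀ := by have := feed82_nonneg d; positivity
  set c : ℝ := collar82 d with hcdef
  have hc0 : 0 ≤ c := (collar82_pos d).le
  have hA : P.Adm K := adm_of_realisesW P Z hP hPK
  have hΓi : ∀ t i, i < j → u (t + i) ≤ Γ * u t := fun t i _ => hΓ t (t + i) (by omega)
  have hΓj : ∀ t, u (t + j) ≤ Γ * u t := fun t => hΓ t (t + j) (by omega)
  have hΓK : ∀ t n, t ≤ n → n ≤ K → u n ≤ Γ * u t := fun t n htn _ => hΓ t n htn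
  -- (i) per-step inequality, collar at the paying level; (ii) A2's lagged sum; (iii) bookings; (iv) arithmetic
  set N : ℕ → ℝ := fun m => compSum L s (fun _ => (1 : ℝ)) P m with hNdef
  set Y' : ℕ → ℝ := fun m => youngVol L s P m + (561 : ℝ) ^ d * (nfresh L s P m : ℝ)
    + c * (N m + (nj j P m : ℝ)) with hY'
  have hstep : ∀ m, m ≤ K → compSum L s (fun v => (v : ℝ)) P m ≤ Y' m + (165 : ℝ) ^ d * (nb j P m : ℝ)
      + (if j ≤ m then (0 : ℝ) * (0 : ℝ) + ε₀ * compSum L s (fun v => (v : ℝ)) P (m - j) else 0) := by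
    intro m _
    have hN0 : 0 ≤ N m := compSum_nonneg (fun _ => zero_le_one) P m
    have hnj0 : (0 : ℝ) ≤ (nj j P m : ℝ) := Nat.cast_nonneg _
    have hextra : (0 : ℝ) ≤ c * (N m + (nj j P m : ℝ)) := by positivity
    by_cases hjm : j ≤ m
    · rw [if_pos hjm]
      have h := perStep82 hL hdrop P Z hP (t := m - j) (m := m) (by omega)
      rw [show m - (m - j) = j by omega] at h
      have hlin := compSum_affine (L := L) (s := s) (feed82 d / 2 ^ j) c P (m - j)
      have hfun : (fun v : ℕ => collar82 d + feed82 d * (v : ℝ) / 2 ^ j) =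
          fun v : ℕ => feed82 d / 2 ^ j * (v : ℝ) + c := by
        funext v; rw [hcdef]; ring
      rw [hfun, hlin] at h
      rw [nb_eq_recent hjm]
      have hlag := compSum_one_lag_le (L := L) (s := s) hjm P hA
      have hmono : c * compSum L s (fun _ => (1 : ℝ)) P (m - j) ≤ c * (N m + (nj j P m : ℝ)) :=
        mul_le_mul_of_nonneg_left hlag hc0
      rw [hY']
      simp only
      linarith
    · rw [if_neg hjm, add_zero, hY']
      have h := compSum_id_le_of_lt_lag82 (show 2 ≤ L by omega) hdrop (by omega : m < j) P Z hP
      simp only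
      linarith
  have hsm : ε₀ * Γ ≤ 1 / 2 := by
    rw [hε₀]
    have h2 : (0 : ℝ) < 2 ^ j := by positivity
    rw [div_mul_eq_mul_div, div_le_iff₀ h2]
    linarith
  have hflat := flat_total_le (u := u) (V := fun m => compSum L s (fun v => (v : ℝ)) P m) (Y := Y')
    (N := fun _ => (0 : ℝ)) (R := fun m => (nb j P m : ℝ)) (K := K) (j := j) (Lu := Γ) (cA := (165 : ℝ) ^ d)
    (cF := (0 : ℝ)) (ε := ε₀) hu (fun t => compSum_nonneg (fun v => Nat.cast_nonneg v) P t) (fun _ => le_rfl)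
    hΓ0 hΓj le_rfl hε0 hstep hsm
  have hLC0 : 0 ≤ lifeCost (dictWT sh R C.n₁) (costT sh C K R) G :=
    lifeCost_nonneg (fun G n => costT_nonneg hE₂ hE₃ G n) G
  have hY := sum_youngVol_le (K := K) (C := C) (R := R) hL hdrop hR hE₂ hE₃ hu huE₂ huE₃ P Z hP
  have hB := sum_bsum_le_lifeCost (K := K) hE₂ hE₃ hsh hW hK
  have hnb := sum_nb_le_bfee (K := K) (j := j) hu hΓi P
  have hnjs := sum_nj_le_jfee (K := K) (j := j) hu hΓi P
  have hjb := jfee_le_bfee hu hΓ0 hΓK P hA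
  have hbb := bfee_le_blin hu P
  have hbfee0 := bfee_nonneg hu P
  have hblin := blin_nonneg hu P
  have hfr := sum_nfresh_le_bfee (L := L) (s := s) (K := K) hu hΓ0 hΓ P
  have hN : ∑ m ∈ Finset.range (K + 1), u m * N m ≤ lifeCost (dictWT sh R C.n₁) (costT sh C K R) G / σ := by
    have h1 := sum_ncomp_floorK_le_lifeCost hL hdrop hR sh hn₁ hE₂ hE₃ K hP hsh hW hK
    rw [le_div_iff₀ hσ, Finset.sum_mul]
    refine le_trans (Finset.sum_le_sum fun t ht => ?_) h1
    rw [Finset.mem_range] at ht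
    have hN0 := compSum_nonneg (L := L) (s := s) (fun _ => zero_le_one) P t
    calc u t * N t * σ = (u t * σ) * compSum L s (fun _ => (1 : ℝ)) P t := by rw [hNdef]; ring
      _ ≤ floorK C K R t * compSum L s (fun _ => (1 : ℝ)) P t := mul_le_mul_of_nonneg_right (huS t (by omega)) hN0
      _ = compSum L s (fun _ => (1 : ℝ)) P t * floorK C K R t := mul_comm _ _
  have hY'sum : ∑ m ∈ Finset.range (K + 1), u m * Y' m =
      ∑ m ∈ Finset.range (K + 1), u m * youngVol L s P m
        + 561 ^ d * ∑ m ∈ Finset.range (K + 1), u m * (nfresh L s P m : ℝ)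
        + c * (∑ m ∈ Finset.range (K + 1), u m * N m + ∑ m ∈ Finset.range (K + 1), u m * (nj j P m : ℝ)) := by
    rw [hY', mul_add, Finset.mul_sum, Finset.mul_sum, Finset.mul_sum, ← Finset.sum_add_distrib,
      ← Finset.sum_add_distrib, ← Finset.sum_add_distrib]
    exact Finset.sum_congr rfl fun m _ => by ring
  set LC := lifeCost (dictWT sh R C.n₁) (costT sh C K R) G with hLC
  have hj0 : (0 : ℝ) ≤ j := Nat.cast_nonneg j
  have t1 : ∑ m ∈ Finset.range (K + 1), u m * (nj j P m : ℝ) ≤ j * Γ * (Γ * blin u P) := by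
    refine hnjs.trans (mul_le_mul_of_nonneg_left (hjb.trans ?_) (by positivity))
    exact mul_le_mul_of_nonneg_left hbb hΓ0
  have t2 : ∑ m ∈ Finset.range (K + 1), u m * (nb j P m : ℝ) ≤ j * Γ * blin u P :=
    hnb.trans (mul_le_mul_of_nonneg_left hbb (by positivity))
  have t3 : ∑ m ∈ Finset.range (K + 1), u m * youngVol L s P m ≤ 2 ^ d * 4 * blin u P + LC := hY.trans (by linarith)
  have t4 : c * (∑ m ∈ Finset.range (K + 1), u m * N m
      + ∑ m ∈ Finset.range (K + 1), u m * (nj j P m : ℝ)) ≤ c * (LC / σ + j * Γ * (Γ * blin u P)) :=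
    mul_le_mul_of_nonneg_left (add_le_add hN t1) hc0
  have t5 : (165 : ℝ) ^ d * ∑ m ∈ Finset.range (K + 1), u m * (nb j P m : ℝ) ≤ 165 ^ d * (j * Γ * blin u P) :=
    mul_le_mul_of_nonneg_left t2 (by positivity)
  have t6 : (561 : ℝ) ^ d * ∑ m ∈ Finset.range (K + 1), u m * (nfresh L s P m : ℝ) ≤ 561 ^ d * (14 * Γ * blin u P) := by
    refine mul_le_mul_of_nonneg_left (hfr.trans ?_) (by positivity)
    exact mul_le_mul_of_nonneg_left hbb (by positivity)
  have hfin : 2 * ((2 ^ d * 4 * blin u P + LC) + 561 ^ d * (14 * Γ * blin u P) + c * (LC / σ + j * Γ * (Γ * blin u P))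
      + 165 ^ d * (j * Γ * blin u P)) =
      (2 + 2 * c / σ) * LC + (2 ^ (d + 3) + 28 * 561 ^ d * Γ + 2 * c * j * Γ ^ 2 + 2 * 165 ^ d * j * Γ) * blin u P := by
    rw [pow_add]; field_simp; ring
  have hflat' : ∑ m ∈ Finset.range (K + 1), u m * compSum L s (fun v => (v : ℝ)) P m ≤
      2 * ((∑ m ∈ Finset.range (K + 1), u m * Y' m)
        + 165 ^ d * ∑ m ∈ Finset.range (K + 1), u m * (nb j P m : ℝ)) := by
    have e0 : (0 : ℝ) * Γ * ∑ m ∈ Finset.range (K + 1), u m * (0 : ℝ) = 0 := by ring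
    linarith [hflat, e0.le, e0.ge]
  rw [hY'sum] at hflat'
  linarith [hflat', t3, t4, t5, t6, hfin.le]

end Assembly

/-! ## §4 The calibrated form: coefficient one on the booked life cost, the explicit class-linear coefficient -/

section Calibrated

/-- **THE CLASS-LINEAR COEFFICIENT OF THE PER-LEVEL DEAD-BOX LEDGER**:
`cvol82 d j Γ = 2^{d+3} + 28·561^d·Γ + 2·collar82 d·j·Γ² + 2·165^d·j·Γ` — the young images (`2^{d+3}`), the fresh-dead
levels (`28·561^d·Γ`), the joins within the lag (`2·collar82 d·j·Γ²`) and the recent old-dead births (`2·165^d·j·Γ`), all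
against the births' class-linear content (M5-2c's birth-credit slack). [folklore] -/
def cvol82 (d j : ℕ) (Γ : ℝ) : ℝ := 2 ^ (d + 3) + 28 * 561 ^ d * Γ + 2 * collar82 d * j * Γ ^ 2 + 2 * 165 ^ d * j * Γ

/-- the coefficient is at least `2^{d+3}` (`Γ ≥ 0`) [folklore] -/
theorem two_pow_le_cvol82 (d j : ℕ) {Γ : ℝ} (hΓ0 : 0 ≤ Γ) : (2 : ℝ) ^ (d + 3) ≤ cvol82 d j Γ := by
  unfold cvol82
  have h1 : (0 : ℝ) ≤ 28 * 561 ^ d * Γ := by positivity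
  have h2 : (0 : ℝ) ≤ 2 * collar82 d * j * Γ ^ 2 := by have := collar82_pos d; positivity
  have h3 : (0 : ℝ) ≤ 2 * 165 ^ d * j * Γ := by positivity
  linarith

/-- the coefficient is positive [folklore] -/
theorem cvol82_pos (d j : ℕ) {Γ : ℝ} (hΓ0 : 0 ≤ Γ) : 0 < cvol82 d j Γ :=
  lt_of_lt_of_le (by positivity) (two_pow_le_cvol82 d j hΓ0)

variable {L : ℕ} {s R : ℕ → ℕ} {C : T4PrintedShapeBanking.Consts} {sh : ε → PEv}

/-- **THE COST SIDE OF THE TOTAL-FORM BINDER, PER-LEVEL DEAD-BOX LEDGER** (ruling R-OWNER-51-1 (3), M5-2e).  Under the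
LAG-FREE floor display `u_t·(6·collar82 d) ≤ floorK C K R t` (`t ≤ K`), M5-1a's `u_n·15·126^d ≤ E₂R_n^{q′}`,
`u_n·24·126^d ≤ E₃R_n^{q′}` (`n ≤ K`), the cumulative growth `u_n ≤ Γ·u_t` (`t ≤ n`, `Γ ≥ 0`), a lag `j ≥ 1` with
`feed82 d·Γ ≤ 2^j∕2`, and the hypotheses of `shrunk82_volume_le`:
`Σ_{m≤K} u_m·V(m) ≤ lifeCost (dictWT sh R C.n₁) (costT sh C K R) G + cvol82 d j Γ·blin u P`. [folklore] -/
theorem shrunk82_volume_le_lifeCost (hL : 4 ≤ L) (hdrop : ∀ m, DropCtl s m) (hR : ∀ t, 1 ≤ R t) (hn₁ : 13 ≤ C.n₁)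
    (hE₂ : 0 ≤ C.E₂) (hE₃ : 0 ≤ C.E₃) {P : PGen (Pt d × Finset (Pt d))} {Z : Finset (Pt d)}
    (hP : RealisesW L s R P Z) {G : Gen ε} (hsh : relabel sh G = P.toGen) (hW : G.WF (dictWT sh R C.n₁)) {K : ℕ}
    (hPK : P.lastStep ≤ K) (hK : K < G.reach (dictWT sh R C.n₁)) {u : ℕ → ℝ} (hu : ∀ n, 0 ≤ u n) {Γ : ℝ}
    (hΓ0 : 0 ≤ Γ) (hΓ : ∀ t n, t ≤ n → u n ≤ Γ * u t) {j : ℕ} (hj1 : 1 ≤ j)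
    (hsmall : feed82 d * Γ ≤ 2 ^ j / 2)
    (huS : ∀ t, t ≤ K → u t * (6 * collar82 d) ≤ floorK C K R t)
    (huE₂ : ∀ n, n ≤ K → u n * (15 * 126 ^ d) ≤ C.E₂ * (R n : ℝ) ^ C.q')
    (huE₃ : ∀ n, n ≤ K → u n * (24 * 126 ^ d) ≤ C.E₃ * (R n : ℝ) ^ C.q') :
    ∑ m ∈ Finset.range (K + 1), u m * compSum L s (fun v => (v : ℝ)) P m ≤
      lifeCost (dictWT sh R C.n₁) (costT sh C K R) G + cvol82 d j Γ * blin u P := by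
  -- apply the raw form to `u′ := 3u` with `σ := 2·collar82 d`: coefficient `2 + 1 = 3`
  set σ : ℝ := 2 * collar82 d with hσdef
  have hc := collar82_pos d
  have hσ : 0 < σ := by rw [hσdef]; positivity
  have hu' : ∀ n, 0 ≤ 3 * u n := fun n => by linarith [hu n]
  have hΓ' : ∀ t n, t ≤ n → 3 * u n ≤ Γ * (3 * u t) := fun t n htn => by nlinarith [hΓ t n htn]
  have huS' : ∀ t, t ≤ K → 3 * u t * σ ≤ floorK C K R t := fun t ht => by
    have := huS t ht; rw [hσdef]; linarith
  have huE₂' : ∀ n, n ≤ K → 3 * u n * (5 * 126 ^ d) ≤ C.E₂ * (R n : ℝ) ^ C.q' := fun n hn => by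
    have := huE₂ n hn; linarith
  have huE₃' : ∀ n, n ≤ K → 3 * u n * (8 * 126 ^ d) ≤ C.E₃ * (R n : ℝ) ^ C.q' := fun n hn => by
    have := huE₃ n hn; linarith
  have h := shrunk82_volume_le (u := fun n => 3 * u n) hL hdrop hR hn₁ hE₂ hE₃ hP hsh hW hPK hK hu' hΓ0 hΓ' hj1
    hsmall hσ huS' huE₂' huE₃'
  have hcoef : (2 + 2 * collar82 d / σ : ℝ) = 3 := by
    rw [hσdef]; field_simp; ring
  rw [hcoef] at h
  have hb : blin (fun n => 3 * u n) P = 3 * blin u P := blin_smul 3 u P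
  have hs : ∑ m ∈ Finset.range (K + 1), 3 * u m * compSum L s (fun v => (v : ℝ)) P m =
      3 * ∑ m ∈ Finset.range (K + 1), u m * compSum L s (fun v => (v : ℝ)) P m := by
    rw [Finset.mul_sum]; exact Finset.sum_congr rfl fun m _ => by ring
  rw [hb, hs] at h
  unfold cvol82
  linarith

end Calibrated

end

end Summit.QuantumFields.BalabanUV.T4Continuum.HistoryBankingShrunkLedger82
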